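import Summits.HodgeConjecture.HodgeConjecture.Theorems.K2E1GroundFieldChangeLocalRingIso   -- ★ p855439 (K2E1-p03 g2): `cm_letter_transport_of_places`, `exists_cmDatum_local_equiv_of_places`, `algebraMap_complexConj`
import Summits.HodgeConjecture.HodgeConjecture.Theorems.K2E1InfinitelyManySplitPlaces     -- ★ p855179 (K2E1-p03 g2): `cm_smul_ne_iff_of_placesOver` (the split token is fibre-independent), ★ `PlacesOver.eq_or_eq_galInv`, `card_eq_two`
import HarnessLib

/-!
# h413 ∕ Track B «K2-LIT», line `K2_E1_TraceFormulaBeta`, row 21 (DEAL E ∕ SQ5, part E-a) — helper `K2E1GroundFieldChangePlaceBijection`: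
# the degree-one bijection of places `β = (· ∩ 𝓞 L)` for a ground-field change `L ⊆ L'`, and row 21's transport from NATURAL place data

Cell `pub/hodgecm-mathlib`, crux H413 = `stmt-HodgeConjecture-24833`, route `HCCMUnconditional`; chair K2-lead (g0), dealer K2E1-plan (g2), DEAL E (SQ5)
2026-09-04T01:32Z to seat K2E1-p09 (g3), REPORT-FIRST 01:41Z (E-a).  THEOREMS ONLY (no `def`, no `instance`, no `notation`, no named-fact hypothesis, no `sorry`);
lane `--kind proof --supports stmt-HodgeConjecture-24833 --as helper`.

★ p855439 `K2E1GroundFieldChangeLocalRingIso.cm_letter_transport_of_places` delivers the isomorphism of local data `U(H)(L⁺_𝔭) ≃ₜ* U(H)(L'⁺_𝔓)` (entrywise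
`Π ι_{βw',w'}`), level matching and the transport of irreducible classes (bijective, admissible ↔ admissible, unramified ↔ unramified) for CM fields `L ⊆ L'`
GIVEN an abstract bijection `β : PlacesOver L' 𝔓 ≃ PlacesOver L 𝔭` with `w' ∣ β w'` of degree one and `β ∘ c̄' = c̄ ∘ β`.  THIS FILE builds `β` from the only
natural candidate, RESTRICTION `w' ↦ w' ∩ 𝓞 L`, and reduces its four hypotheses to plain place combinatorics at `𝔓 ∣ 𝔭`:
* §1 `under_complexConj_smul` — **restriction commutes with complex conjugation**: `(c̄' • w') ∩ 𝓞 L = c̄ • (w' ∩ 𝓞 L)` for every finite place `w'` of `L'`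
  (every embedding of CM fields intertwines the conjugations, ★ `algebraMap_complexConj`; `c̄⁻¹ = c̄`), hence `hβc` for free.
* §2 **`cm_letter_transport_of_under`** ∕ `exists_cmDatum_local_equiv_of_under` — row 21's transport from: (H0) `𝔓 ∣ 𝔭` in the form
  `(w' ∩ 𝓞 L) ∩ 𝓞 L⁺ = 𝔭` for the places `w' ∣ 𝔓`; (D1) `e(w' | w' ∩ 𝓞 L) = f(w' | w' ∩ 𝓞 L) = 1`; (INJ) distinct places above `𝔓` restrict to distinct places of
  `L`; (SURJ) every place of `L` above `𝔭` is the restriction of a place above `𝔓`.  In the REGIME device of the line (`L' = L(√d)`, `K = ℚ(√d)` real quadratic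
  with `p` split, ★ `K2E1RealQuadraticSplitAtP` ∕ ★ `K2E1RealQuadraticTwoPlacesAboveP`) all four are the statement «`𝔭` and every `w ∣ 𝔭` split completely in the
  quadratic steps `L'⁺∕L⁺`, `L'∕L`» (part E-b).
* §3 `injective_and_surjective_under_of_split_iff`, **`cm_letter_transport_of_split_iff`** — (INJ) and (SURJ) are AUTOMATIC once the splitting behaviour matches
  («`𝔓` split in `L'` ⟺ `𝔭` split in `L`»; fibres of a quadratic extension have one or two elements, ★ `PlacesOver.eq_or_eq_galInv` ∕ `card_eq_two`, and
  restriction of distinct conjugate places stays distinct at a split `𝔭` by §1): row 21's transport from (H0) + (D1) + matching.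

HONEST LABEL.  Count-neutral helper; proves no printed statement; HC_CM is proved only modulo the 7 printed citations (2 remaining named inputs: hLiu418 =
`stmt-HodgeConjecture-24832`, h413 = `stmt-HodgeConjecture-24833`) until rung 0 closes.

## References
* [CasselsFrohlichANT1967] J. W. S. Cassels, A. Fröhlich (eds.), *Algebraic Number Theory* (1967), Ch. VII §1.1 («if `w` is over `v` so is `σw`»), Ch. II §10.
* [FrohlichTaylor1990] A. Fröhlich, M. Taylor, *Algebraic Number Theory* (1991), Ch. III §1 (1.14)(a), Thm. 20 (`(L:K) = Σ e f`).
* [Rogawski1990] J. Rogawski, *Automorphic representations of unitary groups in three variables* (1990), §14.2 p. 232 (context: base change of the ground field).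
-/

set_option autoImplicit false
set_option linter.dupNamespace false  -- the mandated namespace repeats the summit's segment (`HodgeConjecture.HodgeConjecture`)

noncomputable section

namespace Summit.HodgeConjecture.HodgeConjecture.Cruxes.H413.K2E1GroundFieldChangePlaceBijection

open NumberField IsDedekindDomain
open scoped MatrixGroups Pointwise
open Literature.NumberTheory.Automorphic Literature.NumberTheory.Automorphic.UnitaryGroup
open Summit.HodgeConjecture.HodgeConjecture.Cruxes.H413.K2E1GroundFieldChangeLocalRingIso

/-! ## §1 Restriction of places commutes with complex conjugation -/

section Conj

variable (L L' : Type) [Field L] [NumberField L] [IsCMField L] [Field L'] [NumberField L'] [IsCMField L'] [Algebra L L']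

/-- **`c̄'` acts on `𝓞 L ⊆ 𝓞 L'` through `c̄`**: `c̄' • ι(x) = ι(c̄ • x)` for `x ∈ 𝓞 L` (★ `algebraMap_complexConj` on the underlying elements). [folklore] -/
theorem complexConj_smul_algebraMap (x : 𝓞 L) :
    IsCMField.complexConj L' • algebraMap (𝓞 L) (𝓞 L') x = algebraMap (𝓞 L) (𝓞 L') (IsCMField.complexConj L • x) := by
  apply RingOfIntegers.ext
  rw [RingOfIntegers.coe_algEquiv_smul]
  change IsCMField.complexConj L' (algebraMap L L' (x : L)) = algebraMap L L' (((IsCMField.complexConj L • x : 𝓞 L)) : L)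
  rw [RingOfIntegers.coe_algEquiv_smul, algebraMap_complexConj]

/-- **RESTRICTION COMMUTES WITH COMPLEX CONJUGATION**: `(c̄' • w') ∩ 𝓞 L = c̄ • (w' ∩ 𝓞 L)` for a finite place `w'` of `L'` and CM fields `L ⊆ L'`
(`x ∈ (c̄' w') ∩ L ⟺ c̄'⁻¹ x ∈ w' ⟺ c̄⁻¹ x ∈ w' ∩ L ⟺ x ∈ c̄ (w' ∩ L)`, since `c̄'` restricts to `c̄`). [cite: CasselsFrohlichANT1967, Ch. VII §1.1] -/
theorem under_complexConj_smul (w' : HeightOneSpectrum (𝓞 L')) :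
    (IsCMField.complexConj L' • w').under (𝓞 L) = IsCMField.complexConj L • (w'.under (𝓞 L)) := by
  -- complex conjugation is an involution: `c̄⁻¹ = c̄` (Mathlib `IsCMField.complexConj_apply_apply`; cf. ★ `RecordSystemConj.complexConj_inv`)
  have hL : (IsCMField.complexConj L)⁻¹ = IsCMField.complexConj L :=
    inv_eq_of_mul_eq_one_right (AlgEquiv.ext fun x => IsCMField.complexConj_apply_apply L x)
  have hL' : (IsCMField.complexConj L')⁻¹ = IsCMField.complexConj L' :=
    inv_eq_of_mul_eq_one_right (AlgEquiv.ext fun x => IsCMField.complexConj_apply_apply L' x)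
  apply HeightOneSpectrum.ext
  ext x
  simp only [HeightOneSpectrum.under_asIdeal, HeightOneSpectrum.smul_asIdeal, Ideal.mem_pointwise_smul_iff_inv_smul_mem, Ideal.under_def,
    Ideal.mem_comap, hL, hL', complexConj_smul_algebraMap]

/-- The same for the inverse conjugations (`c̄⁻¹ = c̄`): `(c̄'⁻¹ • w') ∩ 𝓞 L = c̄⁻¹ • (w' ∩ 𝓞 L)` — the shape of ★ `PlacesOver.galInv`. [cite: CasselsFrohlichANT1967, Ch. VII §1.1] -/
theorem under_complexConj_inv_smul (w' : HeightOneSpectrum (𝓞 L')) :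
    ((IsCMField.complexConj L')⁻¹ • w').under (𝓞 L) = (IsCMField.complexConj L)⁻¹ • (w'.under (𝓞 L)) := by
  have hL : (IsCMField.complexConj L)⁻¹ = IsCMField.complexConj L :=
    inv_eq_of_mul_eq_one_right (AlgEquiv.ext fun x => IsCMField.complexConj_apply_apply L x)
  have hL' : (IsCMField.complexConj L')⁻¹ = IsCMField.complexConj L' :=
    inv_eq_of_mul_eq_one_right (AlgEquiv.ext fun x => IsCMField.complexConj_apply_apply L' x)
  rw [hL, hL', under_complexConj_smul]

end Conj

/-! ## §2 Row 21's transport from natural place data: `β = (· ∩ 𝓞 L)` -/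

section Transport

variable (L L' : Type) [Field L] [NumberField L] [IsCMField L] [Field L'] [NumberField L'] [IsCMField L'] [Algebra L L'] (N : ℕ)
  (H : Matrix (Fin N) (Fin N) L)
  (𝔭 : HeightOneSpectrum (𝓞 ↥(maximalRealSubfield L))) (𝔓 : HeightOneSpectrum (𝓞 ↥(maximalRealSubfield L')))
  (h𝔓𝔭 : ∀ w' : PlacesOver L' 𝔓, ((w'.1).under (𝓞 L)).under (𝓞 ↥(maximalRealSubfield L)) = 𝔭)
  (hdeg : ∀ w' : PlacesOver L' 𝔓, (w'.1).asIdeal.ramificationIdx (𝓞 L) = 1 ∧ (w'.1).asIdeal.inertiaDeg (𝓞 L) = 1)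
  (hinj : ∀ w₁' w₂' : PlacesOver L' 𝔓, (w₁'.1).under (𝓞 L) = (w₂'.1).under (𝓞 L) → w₁' = w₂')
  (hsurj : ∀ w : PlacesOver L 𝔭, ∃ w' : PlacesOver L' 𝔓, (w'.1).under (𝓞 L) = w.1)

include h𝔓𝔭 hinj hsurj in
/-- **THE PLACE DATA OF ★ `cm_letter_transport_of_places` FROM RESTRICTION.**  If `𝔓 ∣ 𝔭` (H0), distinct places above `𝔓` restrict to distinct places of `L` (INJ)
and every place of `L` above `𝔭` is such a restriction (SURJ), then `w' ↦ w' ∩ 𝓞 L` is a bijection `β : PlacesOver L' 𝔓 ≃ PlacesOver L 𝔭` with `w' ∣ β w'`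
and `β (c̄'⁻¹ • w') = c̄⁻¹ • β w'` (§1). [cite: CasselsFrohlichANT1967, Ch. VII §1.1] [cite: FrohlichTaylor1990, Ch. III §1 Thm. 20] -/
theorem exists_placesOver_equiv_under :
    ∃ β : PlacesOver L' 𝔓 ≃ PlacesOver L 𝔭,
      (∀ w' : PlacesOver L' 𝔓, (w'.1).under (𝓞 L) = (β w').1) ∧
      (∀ w' : PlacesOver L' 𝔓, β (PlacesOver.galInv (IsCMField.complexConj L') w') = PlacesOver.galInv (IsCMField.complexConj L) (β w')) := by
  let β₀ : PlacesOver L' 𝔓 → PlacesOver L 𝔭 := fun w' => ⟨(w'.1).under (𝓞 L), h𝔓𝔭 w'⟩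
  have hbij : Function.Bijective β₀ := by
    refine ⟨fun w₁' w₂' h => hinj w₁' w₂' (congrArg Subtype.val h), fun w => ?_⟩
    obtain ⟨w', hw'⟩ := hsurj w
    exact ⟨w', Subtype.ext hw'⟩
  refine ⟨Equiv.ofBijective β₀ hbij, fun w' => rfl, fun w' => Subtype.ext ?_⟩
  change (((IsCMField.complexConj L')⁻¹ • w'.1).under (𝓞 L)) = (IsCMField.complexConj L)⁻¹ • (w'.1).under (𝓞 L)
  exact under_complexConj_inv_smul L L' w'.1

include h𝔓𝔭 hdeg hinj hsurj in
/-- **ROW 21 «letter(L', 𝔓) ⇒ letter(L, 𝔭)» FROM NATURAL PLACE DATA** (★ `cm_letter_transport_of_places` with `β = (· ∩ 𝓞 L)`): for CM `L ⊆ L'`, a place `𝔓` of `L'⁺` above the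
place `𝔭` of `L⁺` (H0) such that every place `w' ∣ 𝔓` of `L'` is of degree one over `w' ∩ 𝓞 L` (D1), with (INJ), (SURJ): there is a homeomorphic group isomorphism
`e : U(H)(L⁺_𝔭) ≃ₜ* U(H ⊗ L')(L'⁺_𝔓)` along which ★ `IrrClass.comap` is BIJECTIVE, preserves ADMISSIBILITY, and carries `U(H)(𝒪_𝔓)`-spherical classes exactly onto
`U(H)(𝒪_𝔭)`-spherical ones. [cite: Rogawski1990, §14.2 p. 232] [cite: CasselsFrohlichANT1967, Ch. II §10] -/
theorem cm_letter_transport_of_under :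
    ∃ (β : PlacesOver L' 𝔓 ≃ PlacesOver L 𝔭) (e : (cmDatum L N H).Local 𝔭 ≃ₜ* (cmDatum L' N (H.map (algebraMap L L'))).Local 𝔓),
      (∀ w' : PlacesOver L' 𝔓, (w'.1).under (𝓞 L) = (β w').1) ∧
      Function.Bijective (IrrClass.comap e) ∧
      (∀ κ : IrrClass ((cmDatum L' N (H.map (algebraMap L L'))).Local 𝔓), (IrrClass.comap e κ).IsAdmissible ↔ κ.IsAdmissible) ∧
      (∀ κ : IrrClass ((cmDatum L' N (H.map (algebraMap L L'))).Local 𝔓),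
        (IrrClass.comap e κ).IsSpherical (cmLocalIntegralLevel L N H 𝔭) ↔
          κ.IsSpherical (cmLocalIntegralLevel L' N (H.map (algebraMap L L')) 𝔓)) := by
  obtain ⟨β, hβ, hβc⟩ := exists_placesOver_equiv_under L L' 𝔭 𝔓 h𝔓𝔭 hinj hsurj
  obtain ⟨e, h1, h2, h3⟩ := cm_letter_transport_of_places L L' N H 𝔭 𝔓 β hβ (fun w' => (hdeg w').1) (fun w' => (hdeg w').2) hβc
  exact ⟨β, e, hβ, h1, h2, h3⟩

include h𝔓𝔭 hdeg hinj hsurj in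
/-- The same with the isomorphism of local data and the level matching exposed (★ `exists_cmDatum_local_equiv_of_places` with `β = (· ∩ 𝓞 L)`): there are
`Φ : Π_{w ∣ 𝔭} L_w ≃+* Π_{w' ∣ 𝔓} L'_{w'}` with `Φ x w' = ι_{w'∩L, w'}(x (w' ∩ 𝓞 L))` and `e` with `e g = Φ(g)` entrywise carrying `U(H)(𝒪_𝔭)` ONTO `U(H)(𝒪_𝔓)`.
[cite: Rogawski1990, §14.2 p. 232] [cite: FrohlichTaylor1990, Ch. III §1 (1.14)(a)] -/
theorem exists_cmDatum_local_equiv_of_under :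
    ∃ (β : PlacesOver L' 𝔓 ≃ PlacesOver L 𝔭) (hβ : ∀ w' : PlacesOver L' 𝔓, (w'.1).under (𝓞 L) = (β w').1)
      (Φ : LocalRing L 𝔭 ≃+* LocalRing L' 𝔓)
      (e : «local» L (IsCMField.complexConj L) N H 𝔭 ≃ₜ* «local» L' (IsCMField.complexConj L') N (H.map (algebraMap L L')) 𝔓),
      (∀ (x : LocalRing L 𝔭) (w' : PlacesOver L' 𝔓), Φ x w' = toPlace (β w').1 (⟨w'.1, hβ w'⟩ : PlacesOver L' (β w').1) (x (β w'))) ∧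
      (∀ g, ((e g : «local» L' (IsCMField.complexConj L') N (H.map (algebraMap L L')) 𝔓) : GL (Fin N) (LocalRing L' 𝔓)) =
        Matrix.GeneralLinearGroup.map (Φ : LocalRing L 𝔭 →+* LocalRing L' 𝔓) (g : GL (Fin N) (LocalRing L 𝔭))) ∧
      (cmLocalIntegralLevel L N H 𝔭).map
          (e : «local» L (IsCMField.complexConj L) N H 𝔭 →* «local» L' (IsCMField.complexConj L') N (H.map (algebraMap L L')) 𝔓) =
        cmLocalIntegralLevel L' N (H.map (algebraMap L L')) 𝔓 := by
  obtain ⟨β, hβ, hβc⟩ := exists_placesOver_equiv_under L L' 𝔭 𝔓 h𝔓𝔭 hinj hsurj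
  obtain ⟨Φ, e, hΦ, he, hlev⟩ := exists_cmDatum_local_equiv_of_places L L' N H 𝔭 𝔓 β hβ
    (fun w' => (hdeg w').1) (fun w' => (hdeg w').2) hβc
  exact ⟨β, hβ, Φ, e, hΦ, he, hlev⟩

end Transport

/-! ## §3 (INJ) and (SURJ) from matching splitting behaviour at `𝔓 ∣ 𝔭` -/

section Split

variable (L L' : Type) [Field L] [NumberField L] [IsCMField L] [Field L'] [NumberField L'] [IsCMField L'] [Algebra L L']
  (𝔭 : HeightOneSpectrum (𝓞 ↥(maximalRealSubfield L))) (𝔓 : HeightOneSpectrum (𝓞 ↥(maximalRealSubfield L')))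
  (h𝔓𝔭 : ∀ w' : PlacesOver L' 𝔓, ((w'.1).under (𝓞 L)).under (𝓞 ↥(maximalRealSubfield L)) = 𝔭)

omit [NumberField L'] [IsCMField L'] [Algebra L L'] in
/-- A place of `L` fixed by `c̄` is the ONLY place above its restriction to `L⁺` (★ `PlacesOver.eq_or_eq_galInv`). [cite: CasselsFrohlichANT1967, Ch. VII Prop. 1.2 (ii)] -/
theorem eq_of_smul_eq {w₀ : PlacesOver L 𝔭} (hfix : IsCMField.complexConj L • w₀.1 = w₀.1) (w : PlacesOver L 𝔭) : w = w₀ := by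
  rcases PlacesOver.eq_or_eq_galInv (IsCMField.complexConj L) (IsCMField.complexConj_ne_one L) w₀ w with h | h
  · exact h
  · rw [h]
    exact Subtype.ext (inv_smul_eq_iff.2 hfix.symm)

include h𝔓𝔭 in
/-- **(INJ) and (SURJ) hold as soon as the splitting behaviour matches**: if `𝔓` splits in `L'∕L'⁺` iff `𝔭` splits in `L∕L⁺` then restriction `w' ↦ w' ∩ 𝓞 L` is a
BIJECTION from the places above `𝔓` onto the places above `𝔭`.  Split case: two places above each, and `w'₂ = c̄'⁻¹ w'₁ ⇒ w'₂ ∩ L = c̄⁻¹ (w'₁ ∩ L) ≠ w'₁ ∩ L` (§1), so the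
restriction is injective between two-element sets; non-split case: one place above each.  [cite: CasselsFrohlichANT1967, Ch. VII Prop. 1.2 (ii)]
[cite: FrohlichTaylor1990, Ch. III §1 Thm. 20] -/
theorem injective_and_surjective_under_of_split_iff
    (hmatch : (∃ w' : PlacesOver L' 𝔓, IsCMField.complexConj L' • w'.1 ≠ w'.1) ↔ (∃ w : PlacesOver L 𝔭, IsCMField.complexConj L • w.1 ≠ w.1)) :
    (∀ w₁' w₂' : PlacesOver L' 𝔓, (w₁'.1).under (𝓞 L) = (w₂'.1).under (𝓞 L) → w₁' = w₂') ∧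
      (∀ w : PlacesOver L 𝔭, ∃ w' : PlacesOver L' 𝔓, (w'.1).under (𝓞 L) = w.1) := by
  let β₀ : PlacesOver L' 𝔓 → PlacesOver L 𝔭 := fun w' => ⟨(w'.1).under (𝓞 L), h𝔓𝔭 w'⟩
  have hβ₀c : ∀ w', β₀ (PlacesOver.galInv (IsCMField.complexConj L') w') = PlacesOver.galInv (IsCMField.complexConj L) (β₀ w') := fun w' =>
    Subtype.ext (under_complexConj_inv_smul L L' w'.1)
  by_cases hsplit : ∃ w : PlacesOver L 𝔭, IsCMField.complexConj L • w.1 ≠ w.1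
  · -- split below: the restriction is injective, and both fibres have two elements
    obtain ⟨w₀, hw₀⟩ := hsplit
    have hinj : Function.Injective β₀ := by
      intro w₁' w₂' h
      rcases PlacesOver.eq_or_eq_galInv (IsCMField.complexConj L') (IsCMField.complexConj_ne_one L') w₁' w₂' with h12 | h12
      · exact h12.symm
      · exfalso
        have hmoved : IsCMField.complexConj L • (β₀ w₁').1 ≠ (β₀ w₁').1 :=
          (Summit.HodgeConjecture.HodgeConjecture.Cruxes.H413.K2E1InfinitelyManySplitPlaces.cm_smul_ne_iff_of_placesOver L (β₀ w₁') w₀).2 hw₀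
        have hne := PlacesOver.galInv_ne (IsCMField.complexConj L) (β₀ w₁') hmoved
        rw [← hβ₀c, ← h12] at hne
        exact hne h.symm
    obtain ⟨w₀', hw₀'⟩ := hmatch.2 ⟨w₀, hw₀⟩
    have hcard : Nat.card (PlacesOver L 𝔭) ≤ Nat.card (PlacesOver L' 𝔓) := by
      rw [PlacesOver.card_eq_two (IsCMField.complexConj L) (IsCMField.complexConj_ne_one L) w₀ hw₀,
        PlacesOver.card_eq_two (IsCMField.complexConj L') (IsCMField.complexConj_ne_one L') w₀' hw₀']
    have hbij := hinj.bijective_of_nat_card_le hcard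
    exact ⟨fun w₁' w₂' h => hinj (Subtype.ext h), fun w => (hbij.2 w).imp fun w' hw' => congrArg Subtype.val hw'⟩
  · -- non-split below (hence above): one place in each fibre
    push Not at hsplit
    have hfix' : ∀ w' : PlacesOver L' 𝔓, IsCMField.complexConj L' • w'.1 = w'.1 := fun w' => by
      by_contra h
      obtain ⟨w, hw⟩ := hmatch.1 ⟨w', h⟩
      exact hw (hsplit w)
    obtain ⟨w₀'⟩ := (inferInstance : Nonempty (PlacesOver L' 𝔓))
    refine ⟨fun w₁' w₂' _ => (eq_of_smul_eq L' 𝔓 (hfix' w₁') w₂').symm, fun w => ⟨w₀', ?_⟩⟩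
    exact congrArg Subtype.val (eq_of_smul_eq L 𝔭 (hsplit w) (β₀ w₀'))

end Split

section TransportSplit

variable (L L' : Type) [Field L] [NumberField L] [IsCMField L] [Field L'] [NumberField L'] [IsCMField L'] [Algebra L L'] (N : ℕ)
  (H : Matrix (Fin N) (Fin N) L)
  (𝔭 : HeightOneSpectrum (𝓞 ↥(maximalRealSubfield L))) (𝔓 : HeightOneSpectrum (𝓞 ↥(maximalRealSubfield L')))
  (h𝔓𝔭 : ∀ w' : PlacesOver L' 𝔓, ((w'.1).under (𝓞 L)).under (𝓞 ↥(maximalRealSubfield L)) = 𝔭)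
  (hdeg : ∀ w' : PlacesOver L' 𝔓, (w'.1).asIdeal.ramificationIdx (𝓞 L) = 1 ∧ (w'.1).asIdeal.inertiaDeg (𝓞 L) = 1)
  (hmatch : (∃ w' : PlacesOver L' 𝔓, IsCMField.complexConj L' • w'.1 ≠ w'.1) ↔ (∃ w : PlacesOver L 𝔭, IsCMField.complexConj L • w.1 ≠ w.1))

include h𝔓𝔭 hdeg hmatch in
/-- **ROW 21's TRANSPORT FROM (H0) + (D1) + MATCHING SPLITTING** (§2 + §3): for CM `L ⊆ L'`, `𝔓 ∣ 𝔭` with every `w' ∣ 𝔓` of degree one over `w' ∩ 𝓞 L` and `𝔓` split in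
`L'` iff `𝔭` split in `L`, there is `e : U(H)(L⁺_𝔭) ≃ₜ* U(H ⊗ L')(L'⁺_𝔓)` with ★ `IrrClass.comap e` bijective, admissible ↔ admissible, unramified ↔ unramified — the
local half of the REGIME device `L ↦ L·K` (there: complete splitting in both quadratic steps gives (D1) and both sides of the matching).
[cite: Rogawski1990, §14.2 p. 232] [cite: CasselsFrohlichANT1967, Ch. II §10, Ch. VII §1.1] -/
theorem cm_letter_transport_of_split_iff :
    ∃ (β : PlacesOver L' 𝔓 ≃ PlacesOver L 𝔭) (e : (cmDatum L N H).Local 𝔭 ≃ₜ* (cmDatum L' N (H.map (algebraMap L L'))).Local 𝔓),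
      (∀ w' : PlacesOver L' 𝔓, (w'.1).under (𝓞 L) = (β w').1) ∧
      Function.Bijective (IrrClass.comap e) ∧
      (∀ κ : IrrClass ((cmDatum L' N (H.map (algebraMap L L'))).Local 𝔓), (IrrClass.comap e κ).IsAdmissible ↔ κ.IsAdmissible) ∧
      (∀ κ : IrrClass ((cmDatum L' N (H.map (algebraMap L L'))).Local 𝔓),
        (IrrClass.comap e κ).IsSpherical (cmLocalIntegralLevel L N H 𝔭) ↔
          κ.IsSpherical (cmLocalIntegralLevel L' N (H.map (algebraMap L L')) 𝔓)) := by
  obtain ⟨hinj, hsurj⟩ := injective_and_surjective_under_of_split_iff L L' 𝔭 𝔓 h𝔓𝔭 hmatch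
  exact cm_letter_transport_of_under L L' N H 𝔭 𝔓 h𝔓𝔭 hdeg hinj hsurj

end TransportSplit

end Summit.HodgeConjecture.HodgeConjecture.Cruxes.H413.K2E1GroundFieldChangePlaceBijection

end
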